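import Literature.NumberTheory.EllipticCurves.FineSelmerFixedFieldMuRoad
import Literature.NumberTheory.IwasawaTheory.ClassicalMuVanishesKleinDescent
import HarnessLib

/-!
# Coates–Sujatha's Conjecture A from `μ = 0` of a subfield `K(E[p])^H` of the division field, `H ≤ Gal(K(E[p])/K)`
# fixing a torsion point — the finite-Galois-group («torsion-point-field descent») form of the seat's Door L9 (proved)

`Proofs`-style file (theorems only: no definition, no named fact, no `sorry`) in topic `NumberTheory/EllipticCurves`,
written by the literature seat `bsd-potss-conjA-anchor` g22 (cell `bsd-potss`; serves the asides
stmt-BirchSwinnertonDyer-19386 / 19413; closes nothing; (A) / BSD is proved for no particular curve here).  It is the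
glue that makes the published-but-unregistered line `fine_pivot` of crux `SmallImageMuZeroOneSign` (cell `bsd-ssimc`,
stmt-BirchSwinnertonDyer-23600) close its stub S2′ `TorsionPointFieldDescent` («`TorsionPointFieldMuAt W p → ConjAAt W p`»)
BY NAME: the hypothesis there is spelled with a subfield `ℚ(E[p])^{⟨σ̄⟩}` of the FINITE Galois extension `ℚ(E[p])/ℚ`
(`fixedField (Subgroup.zpowers (absRestrictNormalHom (W.divisionField p) σ))`), whereas the seat's doors L8/L9
(`CoatesSujatha2005.conjA_of_classicalMuVanishes_stabilizerField` / `…_fixedField`) are spelled with fixed fields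
`K̄^Θ ⊆ K̄` of subgroups of the ABSOLUTE Galois group.

THE THEOREM (`CoatesSujatha2005.conjA_of_classicalMuVanishes_fixedField_divisionField_subgroup`).  `K` a number field,
`E = W/K` elliptic, `p` an ODD prime with `E[p]` IRREDUCIBLE and TAME (`p ∤ #Gal(K(E[p])/K)`), `P ∈ E[p] ∖ 0`,
`H ≤ Gal(K(E[p])/K)` a subgroup all of whose elements fix `P`, `F = K(E[p])^H`.  IF `μ = 0` (growth form
`IwasawaTheory.ClassicalMuVanishes`) for every — equivalently one — cyclotomic `ℤ_p`-extension of `F`, THEN statement (A)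
holds for `E` at `p`: for the cyclotomic `ℤ_p`-extension `κ` of `K` the Pontryagin dual of `Sel₀(E/K_∞)[p^∞]` is
finitely generated over `ℤ_p`.  Corollary `…_fixedField_zpowers`: `H = ⟨σ̄⟩` for one `σ ∈ Γ_K` with `σ • P = P` — verbatim
the shape of `TorsionPointFieldMuAt` in `Summits/…/Cruxes/SmallImageMuZeroOneSign/Lines/fine_pivot.lean` (there `K = ℚ`;
with `σ̄` generating `Stab(P)` the field is `ℚ(P)` of degree `p² − 1` on a `C_ns⁺(p)` row, with `σ̄ = 1` it is
`ℚ(E[p])` itself and the statement is Coates–Sujatha's Thm. 3.4).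

Proof (§2–§3).  With `Θ := res⁻¹(H) ≤ Γ_K` (`res = absRestrictNormalHom (K(E[p]))`): `Gal(K̄/K(E[p])) ≤ Θ ≤ Stab(P)`,
`#res(Θ) ∣ #Gal(K(E[p])/K)` is prime to `p`, and `K̄^Θ` is the copy of `K(E[p])^H` inside `K̄`
(`FineSelmerStabilizerDescent.lift_fixedField_map_absRestrictNormalHom_eq`, Krull); the `μ = 0` hypothesis is moved
from `K(E[p])^H` to `K̄^Θ` along this `K`-isomorphism (§1: both fields have degree dividing `#Gal(K(E[p])/K)`, prime to
`p`, so the cyclotomic tower of either is the RESTRICTION of `κ` — `L ∩ K_∞ = K` — and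
`ClassicalMuVanishesKleinDescent.classicalMuVanishes_restrict_iff_of_algEquiv` compares the two restrictions, while
`classicalMuVanishes_iff_of_isCyclotomic` removes the dependence on the normalisation); then Door L9
(`conjA_of_classicalMuVanishes_fixedField`) applies.  No new mathematics: Krull's correspondence and bookkeeping.

References: [CoatesSujatha2005] J. Coates, R. Sujatha, *Fine Selmer groups of elliptic curves over `p`-adic Lie
extensions*, Math. Ann. 331 (2005) 809–839, §3 Lemma 3.8, Thm. 3.4; [DeoRaySujatha2023] S. V. Deo, A. Ray, R. Sujatha,
*On the μ equals zero conjecture for fine Selmer groups in Iwasawa theory*, Pure Appl. Math. Q. 19 (2023), §3 Thm. 3.9,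
§5 Lemma 5.1 (descent to `ℚ(P)`); [Washington1997] L. C. Washington, *Introduction to Cyclotomic Fields*, 2nd ed., §13.1,
§13.3 Prop. 13.23; [NeukirchANT1999] J. Neukirch, *Algebraic Number Theory*, Ch. IV §1 (Krull's Galois correspondence).
-/

set_option autoImplicit false

noncomputable section

open scoped Classical Pointwise NumberField
open NumberField IsDedekindDomain Field IntermediateField

namespace Literature.NumberTheory.EllipticCurves.FineSelmerStabilizerDescent

open Literature.NumberTheory.GaloisRepresentations Literature.NumberTheory.NumberFields
  Literature.NumberTheory.EllipticCurves Literature.NumberTheory.EllipticCurves.ZpExtension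
  Literature.NumberTheory.IwasawaTheory

variable {K : Type} [Field K] [NumberField K] {p : ℕ} [Fact p.Prime]

/-! ## §1 `μ = 0` for the cyclotomic tower is invariant under `K`-isomorphisms of number fields of degree prime to `p` -/

/-- **Transport of «`μ = 0` for every cyclotomic `ℤ_p`-extension» along a `K`-algebra isomorphism `E ≃ₐ[K] E'` of
number fields of degree prime to `p` over `K`.**  Both cyclotomic towers are the restriction of the cyclotomic
`ℤ_p`-extension `κ` of `K` (`E ∩ K_∞ = K` as `p ∤ [E : K]`, tree `surjective_comp_absGaloisRestrict_of_not_dvd_finrank` and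
`isCyclotomic_restrict`), the two restrictions have layer-wise isomorphic layers
(`classicalMuVanishes_restrict_iff_of_algEquiv`), and `μ = 0` does not depend on the normalisation of the cyclotomic
tower (`classicalMuVanishes_iff_of_isCyclotomic`). [cite: Washington1997, §13.1 (the layers `E·K_n` of `E·K_∞/E`)]
[cite: RaySujatha2021, §1 eq. (1.1)] -/
theorem forall_classicalMuVanishes_of_algEquiv_of_not_dvd_finrank (κ : ZpExtension K p) (hκ : κ.IsCyclotomic)
    {E E' : Type} [Field E] [NumberField E] [Algebra K E] [Field E'] [NumberField E'] [Algebra K E']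
    (φ : E ≃ₐ[K] E') (hE : ¬ p ∣ Module.finrank K E)
    (h : ∀ κ₁ : ZpExtension E p, κ₁.IsCyclotomic → ClassicalMuVanishes κ₁) :
    ∀ κ₂ : ZpExtension E' p, κ₂.IsCyclotomic → ClassicalMuVanishes κ₂ := by
  intro κ₂ hκ₂
  have hE' : ¬ p ∣ Module.finrank K E' := by rwa [← φ.toLinearEquiv.finrank_eq]
  have hsE := surjective_comp_absGaloisRestrict_of_not_dvd_finrank κ E hE
  have hsE' := surjective_comp_absGaloisRestrict_of_not_dvd_finrank κ E' hE'
  have h1 : ClassicalMuVanishes (κ.restrict E hsE) := h _ (isCyclotomic_restrict κ hκ E hsE)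
  have h2 : ClassicalMuVanishes (κ.restrict E' hsE') :=
    (classicalMuVanishes_restrict_iff_of_algEquiv κ φ hsE hsE').mp h1
  exact (classicalMuVanishes_iff_of_isCyclotomic κ₂ (κ.restrict E' hsE') hκ₂ (isCyclotomic_restrict κ hκ E' hsE')).mpr h2

/-! ## §2 The subgroup `res⁻¹(H) ≤ Γ_K` of a subgroup `H ≤ Gal(K(E[p])/K)` -/

variable (W : WeierstrassCurve K) [W.IsElliptic]

omit [Fact p.Prime] in
/-- `Gal(K̄/K(E[p])) ≤ res⁻¹(H)` for every `H ≤ Gal(K(E[p])/K)` (the kernel of the restriction is the fixing group of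
`E[p]`). [cite: SilvermanAEC2009, VIII.§1 (Gal(K(E[m])/K) ↪ Aut(E[m]))] -/
theorem fixingSubgroupOfModule_le_comap_absRestrictNormalHom [NeZero p]
    (H : Subgroup ((W.divisionField p) ≃ₐ[K] (W.divisionField p))) :
    fixingSubgroupOfModule K ↥(W.geomTorsion (p : ℤ)) ≤ H.comap (absRestrictNormalHom (W.divisionField p)) := by
  intro σ hσ
  rw [Subgroup.mem_comap, (W.absRestrictNormalHom_divisionField_eq_one_iff p σ).mpr
    ((W.mem_fixingSubgroupOfModule_geomTorsion_iff p).mp hσ)]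
  exact H.one_mem

omit [Fact p.Prime] in
/-- `res⁻¹(H) ≤ Stab(P)` when every `σ ∈ Γ_K` restricting into `H` fixes `P`. [cite: SilvermanAEC2009, VIII.§1] -/
theorem comap_absRestrictNormalHom_le_stabilizer [NeZero p]
    (H : Subgroup ((W.divisionField p) ≃ₐ[K] (W.divisionField p))) (P : ↥(W.geomTorsion (p : ℤ)))
    (hHP : ∀ σ : absoluteGaloisGroup K, absRestrictNormalHom (W.divisionField p) σ ∈ H → σ • P = P) :
    H.comap (absRestrictNormalHom (W.divisionField p)) ≤ MulAction.stabilizer (absoluteGaloisGroup K) P :=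
  fun σ hσ => MulAction.mem_stabilizer_iff.mpr (hHP σ (Subgroup.mem_comap.mp hσ))

omit [Fact p.Prime] in
/-- `res(res⁻¹(H)) = H` (the restriction `Γ_K → Gal(K(E[p])/K)` is onto). [cite: NeukirchANT1999, Ch. IV §1] -/
theorem map_comap_absRestrictNormalHom_divisionField [NeZero p]
    (H : Subgroup ((W.divisionField p) ≃ₐ[K] (W.divisionField p))) :
    (H.comap (absRestrictNormalHom (W.divisionField p))).map (absRestrictNormalHom (W.divisionField p)) = H := by
  refine Subgroup.map_comap_eq_self_of_surjective ?_ H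
  intro g
  obtain ⟨σ, hσ⟩ := AlgEquiv.restrictNormalHom_surjective (AlgebraicClosure K) g
  exact ⟨(absoluteGaloisGroup.toAlgEquiv K).symm σ, hσ⟩

omit [Fact p.Prime] in
/-- `#res(res⁻¹(H))` divides `#Gal(K(E[p])/K)` (Lagrange), hence is prime to `p` on a tame curve.
[cite: NeukirchANT1999, Ch. IV §1] -/
theorem not_dvd_natCard_map_comap_absRestrictNormalHom [NeZero p]
    (H : Subgroup ((W.divisionField p) ≃ₐ[K] (W.divisionField p)))
    (hG : ¬ p ∣ Nat.card ((W.divisionField p) ≃ₐ[K] (W.divisionField p))) :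
    ¬ p ∣ Nat.card ↥((H.comap (absRestrictNormalHom (W.divisionField p))).map
      (absRestrictNormalHom (W.divisionField p))) :=
  fun h => hG (h.trans (Subgroup.card_subgroup_dvd_card _))

omit [Fact p.Prime] in
/-- **`K(E[p])^H ≅ K̄^{res⁻¹(H)}` over `K`**: the subfield of the division field fixed by `H ≤ Gal(K(E[p])/K)` is
`K`-isomorphic to the fixed field in `K̄` of `res⁻¹(H)` (its image under `K(E[p]) ⊆ K̄` IS that field, by Krull's
correspondence `lift_fixedField_map_absRestrictNormalHom_eq`). [cite: NeukirchANT1999, Ch. IV §1 Thm. (1.2)] -/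
theorem nonempty_algEquiv_fixedField_divisionField_fixedField_comap [NeZero p]
    (H : Subgroup ((W.divisionField p) ≃ₐ[K] (W.divisionField p))) :
    Nonempty (↥(fixedField H : IntermediateField K (W.divisionField p)) ≃ₐ[K]
      ↥(fixedField (H.comap (absRestrictNormalHom (W.divisionField p))) :
        IntermediateField K (AlgebraicClosure K))) := by
  have hlift : IntermediateField.lift
      (fixedField (((H.comap (absRestrictNormalHom (W.divisionField p))).map
        (absRestrictNormalHom (W.divisionField p)))) : IntermediateField K (W.divisionField p)) =
      fixedField (H.comap (absRestrictNormalHom (W.divisionField p))) :=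
    lift_fixedField_map_absRestrictNormalHom_eq (W.divisionField p)
      (H.comap (absRestrictNormalHom (W.divisionField p))) (fixingSubgroupOfModule K ↥(W.geomTorsion (p : ℤ)))
      (fixingSubgroupOfModule_le_comap_absRestrictNormalHom W H) (W.divisionField_def p).symm
  rw [map_comap_absRestrictNormalHom_divisionField W H] at hlift
  exact ⟨(IntermediateField.liftAlgEquiv (fixedField H : IntermediateField K (W.divisionField p))).trans
    (IntermediateField.equivOfEq hlift)⟩

omit [Fact p.Prime] in
/-- `[K(E[p])^H : K]` divides `#Gal(K(E[p])/K)` (tower law), hence is prime to `p` on a tame curve.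
[cite: NeukirchANT1999, Ch. IV §1] -/
theorem not_dvd_finrank_fixedField_divisionField [NeZero p]
    (H : Subgroup ((W.divisionField p) ≃ₐ[K] (W.divisionField p)))
    (hG : ¬ p ∣ Nat.card ((W.divisionField p) ≃ₐ[K] (W.divisionField p))) :
    ¬ p ∣ Module.finrank K ↥(fixedField H : IntermediateField K (W.divisionField p)) := by
  intro h
  apply hG
  rw [IsGalois.card_aut_eq_finrank]
  exact h.trans (Dvd.intro _ (Module.finrank_mul_finrank K
    ↥(fixedField H : IntermediateField K (W.divisionField p)) (W.divisionField p)))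

end Literature.NumberTheory.EllipticCurves.FineSelmerStabilizerDescent

/-! ## §3 Statement (A) from `μ = 0` of `K(E[p])^H`, `H` fixing a torsion point -/

namespace Literature.NumberTheory.EllipticCurves.CoatesSujatha2005

open WeierstrassCurve Literature.NumberTheory.IwasawaTheory Literature.NumberTheory.GaloisRepresentations
  Literature.NumberTheory.NumberFields Literature.NumberTheory.EllipticCurves
  Literature.NumberTheory.EllipticCurves.ZpExtension
  Literature.NumberTheory.EllipticCurves.FineSelmerStabilizerDescent

variable {K : Type} [Field K] [NumberField K] (W : WeierstrassCurve K) [W.IsElliptic] {p : ℕ} [Fact p.Prime]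

/-- **Statement (A) from `μ = 0` of the subfield of `K(E[p])` fixed by a subgroup fixing a torsion point (PROVED).**
`E = W` elliptic over a number field `K`, `p` an odd prime with `E[p]` irreducible and tame (`p ∤ #Gal(K(E[p])/K)`),
`P ∈ E[p] ∖ 0`, `H ≤ Gal(K(E[p])/K)` such that every `σ ∈ Γ_K` with `σ|_{K(E[p])} ∈ H` fixes `P`.  If every
(equivalently one) cyclotomic `ℤ_p`-extension of the number field `K(E[p])^H` has vanishing classical `μ`-invariant
(`IwasawaTheory.ClassicalMuVanishes`, growth form), then for the cyclotomic `ℤ_p`-extension `κ` of `K` the Pontryagin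
dual of `Sel₀(E/K_∞)[p^∞]` is finitely generated over `ℤ_p` — Conjecture A of Coates–Sujatha for `E` at `p` over `K_∞`.
(`H = 1`: Coates–Sujatha Thm. 3.4, tree `thm34_…_holds`; `H` = image of `Stab(P)`: Door L8 at `K(P)`; the general case is
Door L9 `conjA_of_classicalMuVanishes_fixedField` at `Θ = res⁻¹(H)` read through Krull's correspondence.)
[cite: CoatesSujatha2005, §3 Thm. 3.4 and Lemma 3.8] [cite: DeoRaySujatha2023, §3 Thm. 3.9 (b) and §5 Lemma 5.1]
[cite: Washington1997, §13.3 Prop. 13.23 (μ = 0 ⟹ bounded p-ranks)] -/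
theorem conjA_of_classicalMuVanishes_fixedField_divisionField_subgroup (hp : p ≠ 2)
    (hirr : W.HasIrreducibleModPGaloisRep p)
    (hG : haveI : NeZero p := ⟨(Fact.out : p.Prime).ne_zero⟩
      ¬ p ∣ Nat.card ((W.divisionField p) ≃ₐ[K] (W.divisionField p)))
    (H : haveI : NeZero p := ⟨(Fact.out : p.Prime).ne_zero⟩
      Subgroup ((W.divisionField p) ≃ₐ[K] (W.divisionField p)))
    (P : ↥(W.geomTorsion (p : ℤ))) (hP0 : P ≠ 0)
    (hHP : haveI : NeZero p := ⟨(Fact.out : p.Prime).ne_zero⟩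
      ∀ σ : absoluteGaloisGroup K, absRestrictNormalHom (W.divisionField p) σ ∈ H → σ • P = P)
    (hμ : haveI : NeZero p := ⟨(Fact.out : p.Prime).ne_zero⟩
      ∀ κF : ZpExtension ↥(fixedField H : IntermediateField K (W.divisionField p)) p,
        κF.IsCyclotomic → ClassicalMuVanishes κF)
    (κ : ZpExtension K p) (hκ : κ.IsCyclotomic) :
    ∃ (γ : absoluteGaloisGroup K) (D : W.FineSelmerDualData κ γ),
      Module.Finite ℤ_[p] (RestrictScalars ℤ_[p] (IwasawaAlgebra p) D.X) := by
  have hpr : p.Prime := Fact.out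
  haveI : NeZero p := ⟨hpr.ne_zero⟩
  set Θ : Subgroup (absoluteGaloisGroup K) := H.comap (absRestrictNormalHom (W.divisionField p)) with hΘ
  have hNΘ : fixingSubgroupOfModule K ↥(W.geomTorsion (p : ℤ)) ≤ Θ :=
    fixingSubgroupOfModule_le_comap_absRestrictNormalHom W H
  have hΘP : Θ ≤ MulAction.stabilizer (absoluteGaloisGroup K) P := comap_absRestrictNormalHom_le_stabilizer W H P hHP
  have hH : ¬ p ∣ Nat.card ↥(Θ.map (absRestrictNormalHom (W.divisionField p))) :=
    not_dvd_natCard_map_comap_absRestrictNormalHom W H hG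
  -- the `μ = 0` hypothesis, moved from `K(E[p])^H` to its copy `K̄^Θ ⊆ K̄`
  have hN : IsOpen ((fixingSubgroupOfModule K ↥(W.geomTorsion (p : ℤ)) : Subgroup (absoluteGaloisGroup K)) :
      Set (absoluteGaloisGroup K)) := W.isOpen_fixingSubgroupOfModule_geomTorsion p
  have hΘopen : IsOpen (Θ : Set (absoluteGaloisGroup K)) := Subgroup.isOpen_mono hNΘ hN
  haveI : FiniteDimensional K ↥(fixedField Θ : IntermediateField K (AlgebraicClosure K)) :=
    finiteDimensional_fixedField_of_isOpen Θ hΘopen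
  haveI : NumberField ↥(fixedField Θ : IntermediateField K (AlgebraicClosure K)) := NumberField.of_module_finite K _
  haveI : NumberField ↥(fixedField H : IntermediateField K (W.divisionField p)) := NumberField.of_module_finite K _
  obtain ⟨φ⟩ := nonempty_algEquiv_fixedField_divisionField_fixedField_comap W H
  have hμ' : ∀ κF : ZpExtension ↥(fixedField Θ : IntermediateField K (AlgebraicClosure K)) p,
      κF.IsCyclotomic → ClassicalMuVanishes κF :=
    forall_classicalMuVanishes_of_algEquiv_of_not_dvd_finrank κ hκ φ
      (not_dvd_finrank_fixedField_divisionField W H hG) hμ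
  exact conjA_of_classicalMuVanishes_fixedField W hp hirr Θ hNΘ P hP0 hΘP hH hμ' κ hκ

/-- **Corollary (the shape of `fine_pivot`'s S2′ `TorsionPointFieldDescent`): statement (A) from `μ = 0` of
`K(E[p])^{⟨σ̄⟩}` for ONE `σ ∈ Γ_K` fixing a non-zero `P ∈ E[p]`.**  `E = W` elliptic over a number field `K`, `p` odd,
`E[p]` irreducible and tame (`p ∤ #Gal(K(E[p])/K)`), `σ • P = P ≠ 0`: if every (equivalently one) cyclotomic
`ℤ_p`-extension of the subfield of `K(E[p])` fixed by `σ̄ = σ|_{K(E[p])}` has `μ = 0` (growth form), then for the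
cyclotomic `ℤ_p`-extension `κ` of `K` the dual fine Selmer group of `E` over `K_∞` is finitely generated over `ℤ_p`.
(Over `K = ℚ`, on a row with `C_ns⁺(p)`-image, `σ̄` a generator of the stabiliser of `P`: the field is `ℚ(P)` of degree
`p² − 1`; with `σ̄ = 1` it is `ℚ(E[p])` — Coates–Sujatha Thm. 3.4.)
[cite: CoatesSujatha2005, §3 Thm. 3.4 and Lemma 3.8] [cite: DeoRaySujatha2023, §3 Thm. 3.9 (b) and §5 Lemma 5.1]
[cite: Washington1997, §13.3 Prop. 13.23] -/
theorem conjA_of_classicalMuVanishes_fixedField_zpowers (hp : p ≠ 2) (hirr : W.HasIrreducibleModPGaloisRep p)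
    (hG : haveI : NeZero p := ⟨(Fact.out : p.Prime).ne_zero⟩
      ¬ p ∣ Nat.card ((W.divisionField p) ≃ₐ[K] (W.divisionField p)))
    (σ : absoluteGaloisGroup K) (P : ↥(W.geomTorsion (p : ℤ))) (hP0 : P ≠ 0) (hσP : σ • P = P)
    (hμ : haveI : NeZero p := ⟨(Fact.out : p.Prime).ne_zero⟩
      ∀ κF : ZpExtension ↥(fixedField (Subgroup.zpowers (absRestrictNormalHom (W.divisionField p) σ)) :
        IntermediateField K (W.divisionField p)) p, κF.IsCyclotomic → ClassicalMuVanishes κF)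
    (κ : ZpExtension K p) (hκ : κ.IsCyclotomic) :
    ∃ (γ : absoluteGaloisGroup K) (D : W.FineSelmerDualData κ γ),
      Module.Finite ℤ_[p] (RestrictScalars ℤ_[p] (IwasawaAlgebra p) D.X) := by
  have hpr : p.Prime := Fact.out
  haveI : NeZero p := ⟨hpr.ne_zero⟩
  refine conjA_of_classicalMuVanishes_fixedField_divisionField_subgroup W hp hirr hG
    (Subgroup.zpowers (absRestrictNormalHom (W.divisionField p) σ)) P hP0 ?_ hμ κ hκ
  -- every `τ` restricting to a power of `σ̄` fixes `P`: `τ = ν σ^k` with `ν` fixing `E[p]` pointwise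
  intro τ hτ
  obtain ⟨k, hk⟩ := Subgroup.mem_zpowers_iff.mp hτ
  have hν : absRestrictNormalHom (W.divisionField p) (τ * (σ ^ k)⁻¹) = 1 := by
    rw [map_mul, map_inv, map_zpow, ← hk, mul_inv_cancel]
  have hfix := (W.absRestrictNormalHom_divisionField_eq_one_iff p (τ * (σ ^ k)⁻¹)).mp hν
  have hσk : σ ^ k • P = P :=
    MulAction.mem_stabilizer_iff.mp (Subgroup.zpow_mem _ (MulAction.mem_stabilizer_iff.mpr hσP) k)
  calc τ • P = (τ * (σ ^ k)⁻¹ * σ ^ k) • P := by rw [inv_mul_cancel_right]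
    _ = (τ * (σ ^ k)⁻¹) • (σ ^ k • P) := mul_smul _ _ _
    _ = P := by rw [hσk, hfix P]


/-! ## §4 Over `ℚ`: the spelling of `fine_pivot`'s `TorsionPointFieldMuAt W p → ConjAAt W p` -/

/-- **Over `ℚ` (the S2′ shape verbatim).**  `E = W/ℚ` elliptic, `p` odd, `E[p]` irreducible, `p ∤ #Gal(ℚ(E[p])/ℚ)`: IF there
are `σ ∈ Γ_ℚ` and `P ∈ E[p] ∖ 0` with `σ • P = P` such that every cyclotomic `ℤ_p`-extension of `ℚ(E[p])^{⟨σ̄⟩}` has `μ = 0`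
(this is `TorsionPointFieldMuAt W p` of `Cruxes/SmallImageMuZeroOneSign/Lines/fine_pivot.lean`, written out), THEN for every
cyclotomic `ℤ_p`-extension `κ` of `ℚ` the dual fine Selmer group of `E` over `ℚ_∞` is finitely generated over `ℤ_p` (this is
`Rank1Residual.ConjAAt W p`, written out).  On the domain of crux `SmallImageMuZeroOneSign` (good supersingular `p ≥ 3`,
`a_p = 0`, not surjective, no CM) the image of `ρ̄_{E,p}` is `C_ns⁺(p)` or `C_ns(p)`, of order dividing `2(p² − 1)`, and
`E[p]` is irreducible, so the two standing hypotheses hold there (cell `bsd-ssimc`, `Theorems/SignedLowerHalvesSmallImageMuZeroOneSignClassNumberDoor`).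
[cite: CoatesSujatha2005, §3 Thm. 3.4 and Lemma 3.8] [cite: DeoRaySujatha2023, §3 Thm. 3.9 (b) and §5 Lemma 5.1]
[cite: Washington1997, §13.3 Prop. 13.23] -/
theorem conjA_rat_of_exists_classicalMuVanishes_fixedField_zpowers (W : WeierstrassCurve ℚ) [W.IsElliptic] {p : ℕ}
    [Fact p.Prime] (hp : p ≠ 2) (hirr : W.HasIrreducibleModPGaloisRep p)
    (hG : haveI : NeZero p := ⟨(Fact.out : p.Prime).ne_zero⟩
      ¬ p ∣ Nat.card ((W.divisionField p) ≃ₐ[ℚ] (W.divisionField p)))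
    (h : haveI : NeZero p := ⟨(Fact.out : p.Prime).ne_zero⟩
      haveI : NumberField ↥(W.divisionField p) := NumberField.mk
      ∃ (σ : Field.absoluteGaloisGroup ℚ) (P : W.geomTorsion p), P ≠ 0 ∧ σ • P = P ∧
        ∀ κL : ZpExtension ↥(fixedField (Subgroup.zpowers (absRestrictNormalHom (W.divisionField p) σ))) p,
          κL.IsCyclotomic → ClassicalMuVanishes κL) :
    ∀ (κ : ZpExtension ℚ p), κ.IsCyclotomic →
      ∃ (γ : Field.absoluteGaloisGroup ℚ) (D : W.FineSelmerDualData κ γ),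
        Module.Finite ℤ_[p] (RestrictScalars ℤ_[p] (IwasawaAlgebra p) D.X) := by
  intro κ hκ
  obtain ⟨σ, P, hP0, hσP, hμ⟩ := h
  exact conjA_of_classicalMuVanishes_fixedField_zpowers W hp hirr hG σ P hP0 hσP hμ κ hκ

end Literature.NumberTheory.EllipticCurves.CoatesSujatha2005

end
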